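import Mathlib
import Summits.Ventures.HodgeRepro.Tier4.Target
import Summits.Ventures.HodgeRepro.Tier4.Line3.Defs
import Summits.Ventures.HodgeRepro.Tier4.Line3.LocaliserS
import Summits.Ventures.HodgeRepro.Tier4.Line3.ClassBoundDef
import Summits.Ventures.HodgeRepro.Tier4.Line3.TermMajorantMass
import Summits.Ventures.HodgeRepro.Tier4.Line3.SupportMass
import Summits.Ventures.HodgeRepro.Tier4.Line3.TermDominatedAssembly

/-!
# Tier4/Line3/SupportMassBridge — the support-majorant residual implies the choice-independent off-main mass bound

Blind re-derivation cell `pub-hodge-repro`, Tier 4 «PROVE THE STEP» (README §9–§10), LINE L3, seat t4-L2-p3 on L3.5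
`term_dominated` (lead S12234; t4-L2-p1's S12834 reduction `TermDominatedAssembly.term_dominated_of_offMainMass`).

Two displayed residuals of L3.5 are in the tree: t4-L2-p3's `SupportMass.SupportMassBound` (the depth-`N` domain
integral of the support-restricted majorant with the definite Gaussians is `≤ M₀ q₁^N`) and t4-L2-p1's
`TermDominatedAssembly.OffMainMass` (the depth-`N` domain integral of `Σ'_{w off-main} ‖summand (loc N) w z‖ₑ` is
`≤ M₀ q₁^N e^{−κ q^{N/d}}`, CHOICE-INDEPENDENT: a `Γ_N`-invariant density over a fundamental domain).  This module
proves the bridge: the class bound with the definite Gaussians kept (`ClassBoundDef.summand_bound_off_main_def`) turns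
`SupportMassBound c₁ e` (for the `c₁, e` of the class bound) into `OffMainMass` — pointwise
`‖summand‖ₑ ≤ ofReal (B C₁ e^{−κ q^{N/d}}) · ofReal (suppMajorant)` (the summand vanishes off the support), summed over
the off-main tuples and integrated (`lintegral_mono_ae`, `lintegral_const_mul'`).  So the two assemblies agree:
`term_dominated_of_supportMassBound` factors through `term_dominated_of_offMainMass`.

Nothing here asserts anything about the truth of (P); HC_CM is NOT proved by anyone in this repository.
-/

set_option autoImplicit false

noncomputable section

namespace Summit.Ventures.HodgeRepro.Tier4.Line3

open MeasureTheory NumberField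
open scoped ENNReal

namespace T4Data

variable (X : T4Data)

/-- **THE BRIDGE**: the support-majorant residual (for the constants of the class bound) gives the choice-independent
off-main mass bound. -/
theorem offMainMass_of_supportMassBound (D : X.ThetaData)
    (p : IsDedekindDomain.HeightOneSpectrum (RingOfIntegers X.E))
    (L₀ : Submodule (RingOfIntegers X.E) (Fin 3 → X.E)) (xm : X.Tuple)
    (h02 : xm 2 = xm 0) (h13 : xm 3 = xm 1) (hab : LinearIndependent X.E ![xm 0, xm 1]) (ℓ : X.LocS D p L₀ xm)
    (hres : ∀ c₁ e : ℝ, 0 < c₁ → X.SupportMassBound D p L₀ xm ℓ c₁ e) :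
    Nonempty (X.OffMainMass D p L₀ xm ℓ) := by
  obtain ⟨B, e, κ, C₁, c₁, hκ, hB, hC₁, hc₁, hclass⟩ := X.summand_bound_off_main_def D p L₀ xm h02 h13 hab ℓ
  obtain ⟨M₀, hM₀, q₁, hq₁, _hsumm, hmass⟩ := hres c₁ e hc₁
  refine ⟨⟨κ, hκ, B * C₁ * M₀, q₁, by positivity, hq₁, fun N => ?_⟩⟩
  have hdec0 : 0 ≤ X.offMainDecay p κ N := X.offMainDecay_nonneg p κ N
  -- the pointwise bound on the domain
  have hpt : ∀ z ∈ X.domain (ℓ.level N),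
      ∑' w : {w : X.LineTuple // X.orbitOf w ≠ X.orbitOf (X.lines xm)}, ‖X.summand D.Φ D.cf (ℓ.loc N) w.1 z‖ₑ ≤
        ENNReal.ofReal (B * C₁ * X.offMainDecay p κ N) *
          ∑' w, ENNReal.ofReal (X.suppMajorant D ℓ c₁ e N w z) := by
    intro z hz
    have hzb : z ∈ ball := X.domain_subset_ball _ hz
    calc ∑' w : {w : X.LineTuple // X.orbitOf w ≠ X.orbitOf (X.lines xm)}, ‖X.summand D.Φ D.cf (ℓ.loc N) w.1 z‖ₑ
        ≤ ∑' w : {w : X.LineTuple // X.orbitOf w ≠ X.orbitOf (X.lines xm)},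
            ENNReal.ofReal (B * C₁ * X.offMainDecay p κ N) * ENNReal.ofReal (X.suppMajorant D ℓ c₁ e N w.1 z) := by
          refine ENNReal.tsum_le_tsum fun w => ?_
          rw [← ofReal_norm, ← ENNReal.ofReal_mul (by positivity)]
          refine ENNReal.ofReal_le_ofReal ?_
          unfold suppMajorant
          by_cases hw : w.1 ∈ X.suppSet D ℓ N
          · rw [Set.indicator_of_mem hw]
            have h := hclass N w.1 z hzb w.2
            unfold offMainDecay
            calc ‖X.summand D.Φ D.cf (ℓ.loc N) w.1 z‖ ≤ B * X.majorantDefAt c₁ D.Φ e w.1 z *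
                  (C₁ * Real.exp (-(κ * (((Ideal.absNorm p.asIdeal : ℝ) ^ N) ^ ((Module.finrank ℚ X.E : ℝ)⁻¹))))) := h
              _ = B * C₁ * Real.exp (-(κ * (((Ideal.absNorm p.asIdeal : ℝ) ^ N) ^ ((Module.finrank ℚ X.E : ℝ)⁻¹)))) *
                  X.majorantDefAt c₁ D.Φ e w.1 z := by ring
          · rw [Set.indicator_of_notMem hw, mul_zero]
            have hcoef : X.coefQ D.cf (ℓ.loc N) (X.rep w.1) = 0 := by
              by_contra h
              exact hw h
            unfold summand
            rw [hcoef, zero_mul, norm_zero]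
      _ = ENNReal.ofReal (B * C₁ * X.offMainDecay p κ N) *
            ∑' w : {w : X.LineTuple // X.orbitOf w ≠ X.orbitOf (X.lines xm)},
              ENNReal.ofReal (X.suppMajorant D ℓ c₁ e N w.1 z) := ENNReal.tsum_mul_left
      _ ≤ ENNReal.ofReal (B * C₁ * X.offMainDecay p κ N) *
            ∑' w, ENNReal.ofReal (X.suppMajorant D ℓ c₁ e N w z) :=
          mul_le_mul_right (ENNReal.tsum_comp_le_tsum_of_injective Subtype.val_injective
            (fun w => ENNReal.ofReal (X.suppMajorant D ℓ c₁ e N w z))) _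
  -- integrate over the domain
  calc ∫⁻ z in X.domain (ℓ.level N),
        ∑' w : {w : X.LineTuple // X.orbitOf w ≠ X.orbitOf (X.lines xm)}, ‖X.summand D.Φ D.cf (ℓ.loc N) w.1 z‖ₑ
      ≤ ∫⁻ z in X.domain (ℓ.level N), ENNReal.ofReal (B * C₁ * X.offMainDecay p κ N) *
          ∑' w, ENNReal.ofReal (X.suppMajorant D ℓ c₁ e N w z) :=
        lintegral_mono_ae ((ae_restrict_iff' (X.measurableSet_domain _)).mpr (Filter.Eventually.of_forall hpt))
    _ = ENNReal.ofReal (B * C₁ * X.offMainDecay p κ N) *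
          ∫⁻ z in X.domain (ℓ.level N), ∑' w, ENNReal.ofReal (X.suppMajorant D ℓ c₁ e N w z) :=
        lintegral_const_mul' _ _ ENNReal.ofReal_ne_top
    _ ≤ ENNReal.ofReal (B * C₁ * X.offMainDecay p κ N) * ENNReal.ofReal (M₀ * q₁ ^ N) :=
        mul_le_mul_right (hmass N) _
    _ = ENNReal.ofReal (B * C₁ * M₀ * q₁ ^ N * X.offMainDecay p κ N) := by
        rw [← ENNReal.ofReal_mul (by positivity)]
        congr 1
        ring

/-- L3.5 through the bridge: the support-majorant residual, via `OffMainMass`, gives `term_dominated`'s conclusion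
(the same conclusion as `SupportMass.term_dominated_of_supportMassBound`, without `hq`). -/
theorem term_dominated_of_supportMassBound' (D : X.ThetaData)
    (p : IsDedekindDomain.HeightOneSpectrum (RingOfIntegers X.E))
    (L₀ : Submodule (RingOfIntegers X.E) (Fin 3 → X.E)) (xm : X.Tuple)
    (h02 : xm 2 = xm 0) (h13 : xm 3 = xm 1) (hab : LinearIndependent X.E ![xm 0, xm 1]) (ℓ : X.LocS D p L₀ xm)
    (hres : ∀ c₁ e : ℝ, 0 < c₁ → X.SupportMassBound D p L₀ xm ℓ c₁ e) :
    ∃ bound : X.Orbit → ℝ, (∀ o, 0 ≤ bound o) ∧ Summable bound ∧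
      ∀ N (o : X.Orbit), o ≠ X.orbitOf (X.lines xm) →
        ‖X.term D.Φ D.cf (ℓ.level N) (ℓ.loc N) o‖ ≤ bound o := by
  obtain ⟨H⟩ := X.offMainMass_of_supportMassBound D p L₀ xm h02 h13 hab ℓ hres
  exact X.term_dominated_of_offMainMass D ℓ H

end T4Data

end Summit.Ventures.HodgeRepro.Tier4.Line3

end
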